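import Literature.MathematicalPhysics.QuantumFieldTheory.Balaban1983to89.Node00.Record13
import Literature.MathematicalPhysics.QuantumFieldTheory.Balaban1983to89.Node00.Record13SepCoPH
import Literature.MathematicalPhysics.QuantumFieldTheory.Balaban1983to89.Node00.Record13Carriers
import Literature.MathematicalPhysics.QuantumFieldTheory.Balaban1983to89.Node00.CarriersB8
import Literature.MathematicalPhysics.QuantumFieldTheory.Balaban1983to89.Node00.Record13SClassSepCoPH
import Literature.MathematicalPhysics.QuantumFieldTheory.Balaban1983to89.Node00.N24NodesWindowStage12C
import Literature.MathematicalPhysics.QuantumFieldTheory.Balaban1983to89.T4DatumAssemblyTower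
import Summits.QuantumFields.YangMills.Theses.BalabanUVNodes
import Summits.QuantumFields.YangMills.Theorems.BalabanUVNodesK1BetaWindow13SOfNodes13PWSOfBoxH

/-!
# BalabanUVNodes ∕ K1⁷ — THE CRUX's CONSEQUENT FROM RUNG 1 AND THE **SIGN** β-BOX AT THE WITNESS: the END headline's floor letter is the SIGN `0 ≤ β`, NOT asymptotic
# freedom — `StabilityBAtRecordR13SepCoPH` follows from the registered STUB 1 `stub_nodes13PWS` and, at every rung-1 witness, `BetaLowerH 0 γ₀ β_θ` +
# `BetaUpperH w.βup γ₀ β_θ` (K1⁷'s NODE-O debt is the sign letter `FlowStep.BetaSignH`-at-the-witness, one notch below rung 2's `0 < w.b ≤ β`)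

TRACK A (YM-PLAN §2d), node N24 (binder B2, COMPOSITE), WIDTH SEAT `pub-ymgap-dag-n24-w1` (director-ym №197 ∕ HUMAN RULING D-0149; plan g77 W-SEAT-START-LIST v2 §1 n24
ITEM 1, second module).  Key of record: K1⁷ `StabilityBAtRecordR13SepCoPH` = stmt-QuantumFields-20542; `--supports` it AS A HELPER (count-neutral).  Companion of this seat's
`BalabanUVNodesK1BetaWindow13SOfNodes13PWSOfBoxH` (rung 1 ⇒ rung 2 modulo the β-box with a POSITIVE floor, the currency the registered rung 2 `BetaWindowAtSomeRecord13S` fixes through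
`WorldP.b_pos : 0 < w.b` in `BetaBoundsInInterval w.C.toB12 w.γ w.b w.βup`).

THE LOCATED POINT (DagBinding's own words at `flowIneq26_of_alongRun`: «the world's `b > 0` (only `0 ≤ β` is used)»; `Step.B14_2_6d_of_betaNonneg`; `B14.flowIneq26_of_rg_two_sided`):
the END headline `DagBinding.endStatementBPrinted_of_nodesP_interval` consumes the interval β-binder ONLY to produce the flow-control leaf (2.6) [Balaban1988Convergent] p. 255 along
in-interval runs, and (2.6) follows from (0.20) + `0 ≤ β_{j+1}(g_j) ≤ β⁺` + positive couplings — the SIGN of β, not a positive floor.  Rung 2 as registered asks the AF floor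
`0 < w.b ≤ β` (T09.F strong form `FlowStep.BetaAFH`); the crux's consequent needs one notch less.  Nothing of the registered skeleton is changed or re-registered here (plan
owns the stub texts); this file proves the WEAKER-INPUT COMPOSITION next to it, by name, so that whoever supplies the β-side at a rung-1 witness may stop at the sign:

* §1 `endStatementBPrinted_of_nodesP_interval_sign` — the END headline with floor `0`: a dependence-function world `w`, `0 < w.γ ≤ γ₀`, the thirteen nodes at every run, the
  GUARDED (0.20) leaf (`smallCouplings → rgFlow`, which every record world has by name) and `BetaBoundsInInterval w.C.toB12 γ₀ 0 w.βup` ⊢ `B16.EndStatementBPrinted w.C`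
  (DagBinding's proof verbatim with `B14.flowIneq26_of_rg_two_sided` fed the sign instead of `w.b_pos`); `endStatementBPrinted_of_nodesP_alongRuns_sign` — the MINIMAL β-input:
  sign and ceiling asked ONLY at the points `g_j`, `j < K`, of in-window runs (what `Dag.uv_stability_of_series` reads through (2.6)).
* §2 — (no decl) the floor-`0` binder at the datum of record is the companion's `betaBoundsInInterval_datumOfRecord₁₃SepCoPH_of_boxH` at `b := 0`.
* §3 ★ `stabilityB_body_of_rung1At_of_signBoxH` (general `N`) — FROM ANY RUNG-1 DATUM `(θ, h, w)` (unity ∧ non-degeneracy, admissibility, plan's `RecordS` spelled out, the thirteen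
  nodes at every run) AND `0 < γ₀`, `BetaLowerH 0 γ₀ β_θ`, `BetaUpperH w.βup γ₀ β_θ`: the crux's consequent AT `θ` — `EndStatementBPrinted (datumOfRecord₁₃SepCoPH θ h).C` ∧ the window
  (world re-lettered to `γ := min w.γ γ₀` by the companion's `nodes_leavesP_reletter_of_le_all` ∕ `isRecordOfRecord₁₃CSepCoPHS_reletter_of_le`; the guarded (0.20) leaf by dag-n10-d's
  `rgFlow_of_smallCouplings_of_isRecordOfRecord₁₃CSepCoPHS`; the window by n24-a's `N24_window_of_betaUpperH`); `endStatementBPrinted_window_of_isRecordOfRecord₁₃CSepCoPHS_of_nodes_of_signBoxH` —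
  the D-keyed twin at any S-class record; `endStatementBPrinted_of_rung1At_of_alongRuns_sign` — (B) at θ from the RUN-WISE sign ∕ ceiling letters only (no box; window not produced).
* §4 ★★ `stabilityBAtRecordR13SepCoPH_body_of_nodes13PWS_of_signBoxH_at_witness` (`N = 2`) — the registered rung-1 text `NodesAtSomeRecord13PWS F` (verbatim, `RecordS` unfolded) and
  «at every rung-1 witness: `∃ γ₀ > 0, BetaLowerH 0 γ₀ β_θ ∧ BetaUpperH w.βup γ₀ β_θ`» ⊢ the crux's consequent for `F` (its ∃-text verbatim).
* §5 ★★★ `stabilityBAtRecordR13SepCoPH_of_stub1_of_signBoxH_at_witness` — THE ROUTE DECL `Summit.QuantumFields.YangMills.Theses.BalabanUVNodes.StabilityBAtRecordR13SepCoPH` BY NAME from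
  the registered STUB 1 text (`∀ F, Inhabited13 F → NodesAtSomeRecord13PWS F`, bodies verbatim) and the sign-box-at-witness letter for every `F` — an ALTERNATIVE kernel-checked
  composition beside plan's `StabilityBAtRecordR13SepCoPH_of stub_nodes13PWS stub_betaWindow13PWS`, with the β-side input weakened from AF to SIGN.
* §6 `stabilityB_body_of_rung1At_of_drift_atSlopeCont_sign` — §3 with the sign box BY NAME from the K2 letters (N26 `betaBox_betaOfRecord₁₃_of_drift_atSlopeCont` at `b := 0`):
  NON-STRICT floor `2A + s ≤ d`, ceiling `d + 2A + s ≤ w.βup`.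

HONEST SCOPE ∕ A6.  Implications only; the sign ∕ ceiling letters and stub 1 are DISPLAYED HYPOTHESES (NODE O ∕ K2⁷ ∕ K0⁷ 3ᴬ ∕ K1⁷ stub 1 own them), inhabited at NO θ here («not
exhibited», №167); the sign `0 ≤ β` is UNPRINTED (T09.F weak form; [Balaban1989LargeFieldII] p. 355 refers the β-properties to an unpublished paper) exactly like the AF floor — the gain is
one notch of strength, not a discharge.  Nothing of Bałaban's asserted; K1⁷ NOT closed; N24 COMPOSITE — no discharge, no count claim (typed 28∕28 · discharged 5∕27 unmoved).  One finite 𝕋⁴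
programme at fixed ε, Bałaban AS PRINTED; R4 closes ONLY the conditional finite-𝕋⁴ rung `BalabanLadder.UV` — the YM mass gap (Clay) is NOT proved by any of this; nothing continuum ∕ ℝ⁴ ∕ OS.
Theorems only: no `def`, no `instance`, no `sorry`, standard axioms.
-/

noncomputable section

open scoped Matrix.Norms.L2Operator

namespace Summit.QuantumFields.YangMills.BalabanUVNodes.K1EndOfNodes13PWSOfSignBoxH

open Literature.MathematicalPhysics.QuantumFieldTheory.Balaban1983to89
open Literature.MathematicalPhysics.QuantumFieldTheory.Balaban1983to89.Node00
open DagBinding T4Continuum T4DatumAssembly FlowStepRuns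
open FlowStep (BetaLowerH BetaUpperH box_mono)
open Literature.MathematicalPhysics.QuantumFieldTheory.Balaban1983to89.Beta.Drift (OneLoopDrift)
open Summit.QuantumFields.BalabanUV.Gaps.BetaContFromD4Chain (AtSlopeCont)
open Summit.QuantumFields.YangMills.Theorems.BalabanUVNodesN26AtRecord13BetaBoxOfDriftAtSlope (betaBox_betaOfRecord₁₃_of_drift_atSlopeCont)
open Summit.QuantumFields.YangMills.BalabanUVNodes.K1BetaWindow13SOfNodes13PWSOfBoxH
  (nodes_leavesP_reletter_of_le_all isRecordOfRecord₁₃CSepCoPHS_reletter_of_le betaBoundsInInterval_datumOfRecord₁₃SepCoPH_of_boxH)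

/-! ## §1. The END headline with the SIGN floor -/

section Headline

/-- **THE END HEADLINE WITH FLOOR `0` (the SIGN of β), GUARDED (0.20) LEAF.**  For a dependence-function world `w` with `0 < w.γ ≤ γ₀`: the thirteen paper nodes at the `leavesP`
binding of every run, the (0.20) leaf along in-interval runs, and `0 ≤ β_{j+1}(x) ≤ w.βup` on `]0, γ₀]` with in-interval history (`BetaBoundsInInterval w.C.toB12 γ₀ 0 w.βup`) give the
PINNED end statement `B16.EndStatementBPrinted w.C` ([Balaban1989LargeFieldII] Thm 1 ∧ [Balaban1988Convergent] Cor. 3).  = `DagBinding.endStatementBPrinted_of_nodesP_interval` with its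
`w.b_pos` use replaced by the sign (`B14.flowIneq26_of_rg_two_sided` reads `0 ≤ β` only; `Step.B14_2_6d_of_betaNonneg`).  Pure bookkeeping over the DAG composition
`Dag.uv_stability_of_series`. [cite: Balaban1989LargeFieldII, Thm 1 p.355 + p.391; Balaban1988Convergent, (2.6) p.255 and Cor. 3 (2.50) p.264; Balaban1987RG1, (0.20) p.256 and (1.22) p.264] -/
theorem endStatementBPrinted_of_nodesP_interval_sign (w : WorldP) (hγ : 0 < w.γ) {γ₀ : ℝ} (hγ₀ : w.γ ≤ γ₀)
    (hnodes : ∀ P : B12.RunParams, Nodes (leavesP w P)) (hrg : ∀ P : B12.RunParams, (leavesP w P).smallCouplings → (leavesP w P).rgFlow)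
    (hβ : BetaBoundsInInterval w.C.toB12 γ₀ 0 w.βup) : B16.EndStatementBPrinted w.C := by
  refine endStatementBPrinted_of_worldsP w hγ fun P => uvStability_of_nodes (leavesP w P) (hnodes P) ?_
  intro hsc
  obtain ⟨hlo, hhi⟩ := alongRun_of_inInterval w.C.toB12 hβ hγ₀ P hsc
  have hpos : ∀ k, k ≤ P.K → 0 < (w.C P).flow.g k := fun k hk => (hsc k hk).1
  by_cases hK : P.K = 0
  · intro m n hmn hnK
    omega
  · have hβup : 0 ≤ w.βup := (hlo 0 (Nat.pos_of_ne_zero hK)).trans (hhi 0 (Nat.pos_of_ne_zero hK))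
    exact B14.flowIneq26_of_rg_two_sided (w.C P).flow P.K w.βup w.β₀ hβup w.β₀_pos.le hpos (hrg P hsc) hhi hlo

/-- **THE MINIMAL β-INPUT OF THE END ROAD: SIGN AND CEILING ALONG IN-WINDOW RUNS ONLY.**  The same headline with the two β letters asked ONLY at the points the composition
reads — `0 ≤ β_{j+1}(g_j) ≤ w.βup`, `j < K`, along runs whose couplings stay in `]0, w.γ]` (no box, no history off the generated one; `BetaBoundsInInterval … 0 …` implies these by
`DagBinding.alongRun_of_inInterval`).  This is exactly what `Dag.uv_stability_of_series` consumes through (2.6). [cite: Balaban1988Convergent, (2.6) p.255; Balaban1989LargeFieldII, Thm 1 p.355 + p.391 (bookkeeping)] -/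
theorem endStatementBPrinted_of_nodesP_alongRuns_sign (w : WorldP) (hγ : 0 < w.γ)
    (hnodes : ∀ P : B12.RunParams, Nodes (leavesP w P)) (hrg : ∀ P : B12.RunParams, (leavesP w P).smallCouplings → (leavesP w P).rgFlow)
    (hhi : ∀ P : B12.RunParams, (leavesP w P).smallCouplings → ∀ j, j < P.K → (w.C P).flow.β (j + 1) ((w.C P).flow.g j) ≤ w.βup)
    (hsign : ∀ P : B12.RunParams, (leavesP w P).smallCouplings → ∀ j, j < P.K → 0 ≤ (w.C P).flow.β (j + 1) ((w.C P).flow.g j)) :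
    B16.EndStatementBPrinted w.C := by
  refine endStatementBPrinted_of_worldsP w hγ fun P => uvStability_of_nodes (leavesP w P) (hnodes P) ?_
  intro hsc
  have hpos : ∀ k, k ≤ P.K → 0 < (w.C P).flow.g k := fun k hk => (hsc k hk).1
  by_cases hK : P.K = 0
  · intro m n hmn hnK
    omega
  · have hβup : 0 ≤ w.βup := (hsign P hsc 0 (Nat.pos_of_ne_zero hK)).trans (hhi P hsc 0 (Nat.pos_of_ne_zero hK))
    exact B14.flowIneq26_of_rg_two_sided (w.C P).flow P.K w.βup w.β₀ hβup w.β₀_pos.le hpos (hrg P hsc) (hhi P hsc) (hsign P hsc)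

/-- The floor-`b` binder for ANY `0 ≤ b` implies the floor-`0` binder (so every consumer of the registered rung 2 also feeds §1). [cite: Balaban1987RG1, (1.22) p.264 (bookkeeping)] -/
theorem betaBoundsInInterval_sign_of_nonneg_floor (C : B12.Construction) {γ₀ b βup : ℝ} (hb : 0 ≤ b) (h : BetaBoundsInInterval C γ₀ b βup) :
    BetaBoundsInInterval C γ₀ 0 βup :=
  fun P j x hj hhist hx hxγ => ⟨hb.trans (h P j x hj hhist hx hxγ).1, (h P j x hj hhist hx hxγ).2⟩

end Headline

/-! ## §3. ★ The crux's consequent AT θ from any rung-1 datum `(θ, h, w)` and the SIGN box at θ -/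

section AtTheta

variable {F : T4Family} {N : ℕ} [NeZero N]

/-- **★ THE CRUX's CONSEQUENT AT θ FROM A RUNG-1 DATUM AND THE SIGN BOX.**  Given a unity Stage-13 tuple `θ` with provisos `h`, `θ.Admissible`, a world `w` in plan's S-bound record class
of the datum (`RecordS`, spelled out = dag-n10-d's `IsRecordOfRecord₁₃CSepCoPHS` at the datum, `recordS₁₃SepCoPH_iff`) all of whose runs' leaf worlds satisfy the thirteen DAG nodes, and the
SIGN box `0 ≤ betaOfRecord₁₃ θ ≤ w.βup` on `]0, γ₀]^{k+1}`, `0 < γ₀`: the body of `StabilityBAtRecordR13SepCoPH` AT `θ` — unity, admissibility, `B16.EndStatementBPrinted (datumOfRecord₁₃SepCoPH θ h).C`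
and the non-vacuity window.  Road: shrink the world's window to `min w.γ γ₀` (nodes kept and still an S-class record — companion file's re-lettering lemmas), guarded (0.20) leaf by `rgFlow_of_smallCouplings_of_isRecordOfRecord₁₃CSepCoPHS`,
floor-`0` binder by the companion's `betaBoundsInInterval_datumOfRecord₁₃SepCoPH_of_boxH` at `b := 0`, END by §1, `w.C = D.C`; window by n24-a's `N24_window_of_betaUpperH` from the upper letter alone.  CONDITIONAL on the two letters (the sign UNPRINTED,
T09.F weak form; the ceiling = [Balaban1987RG1] §1 p.264 «uniformly bounded», proof unpublished); nothing of Bałaban asserted; K1⁷ NOT closed.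
[cite: Balaban1989LargeFieldII, Thm 1 p.355 + (0.1) pp.355–356 + p.391; Balaban1988Convergent, (2.6) p.255, Cor. 3 (2.50) p.264; Balaban1987RG1, (0.17)–(0.20) pp.255–256, §1 (1.22) p.264; Balaban1988Convergent, (0.4) p.235 (non-vacuity)] -/
theorem stabilityB_body_of_rung1At_of_signBoxH (θ : Stage13HParams F N) (h : θ.Provisos₁₃SepCoPH F N) (w : WorldP)
    (hU : θ.ZhUnity F N ∧ θ.SlotsNondegenerate₁₃ F N) (hθ : θ.Admissible F N)
    (hR : ∃ (θ' : Stage13HParams F N) (h' : θ'.Provisos₁₃SepCoPH F N), θ'.Admissible F N ∧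
      datumOfRecord₁₃SepCoPH F N θ h = datumOfRecord₁₃SepCoPH F N θ' h' ∧ w.C = (datumOfRecord₁₃SepCoPH F N θ h).C ∧ (0 < w.γ ∧ w.γ ≤ θ'.γ) ∧
      w.L = (θ'.L : ℝ) ∧ ∀ P : B12.RunParams, w.up P = upOfRecord₅CS F N (θ'.toStage5₁₃CoPH F N) P)
    (hnodes : ∀ P : B12.RunParams, Nodes (leavesP w P))
    {γ₀ : ℝ} (hγ₀ : 0 < γ₀)
    (hsign : BetaLowerH 0 γ₀ (betaOfRecord₁₃ F N θ.toStage13Params)) (hhi : BetaUpperH w.βup γ₀ (betaOfRecord₁₃ F N θ.toStage13Params)) :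
    (θ.ZhUnity F N ∧ θ.SlotsNondegenerate₁₃ F N) ∧ θ.Admissible F N ∧ B16.EndStatementBPrinted (datumOfRecord₁₃SepCoPH F N θ h).C ∧
      ∃ γ₁ : ℝ, 0 < γ₁ ∧ ∀ γ : ℝ, 0 < γ → γ ≤ γ₁ → ∃ P : B12.RunParams, 1 ≤ P.K ∧ ((datumOfRecord₁₃SepCoPH F N θ h).C P).flow.InInterval γ P.K := by
  have hRS : IsRecordOfRecord₁₃CSepCoPHS F N (datumOfRecord₁₃SepCoPH F N θ h) w := (recordS₁₃SepCoPH_iff F N θ h w).1 hR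
  have hγw : 0 < w.γ := gamma_pos_of_isRecordOfRecord₁₃CSepCoPHS hRS
  have hC : w.C = (datumOfRecord₁₃SepCoPH F N θ h).C := construction_eq_of_isRecordOfRecord₁₃CSepCoPHS hRS
  -- the world with its window shrunk into the box (floor letter carried along unchanged; the companion's re-lettering lemmas)
  have hRS' : IsRecordOfRecord₁₃CSepCoPHS F N (datumOfRecord₁₃SepCoPH F N θ h) { w with γ := min w.γ γ₀, b := w.b, b_pos := w.b_pos } :=
    isRecordOfRecord₁₃CSepCoPHS_reletter_of_le hRS (lt_min hγw hγ₀) (min_le_left _ _) w.b_pos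
  have hB : B16.EndStatementBPrinted ({ w with γ := min w.γ γ₀, b := w.b, b_pos := w.b_pos } : WorldP).C :=
    endStatementBPrinted_of_nodesP_interval_sign { w with γ := min w.γ γ₀, b := w.b, b_pos := w.b_pos } (lt_min hγw hγ₀) (min_le_right w.γ γ₀)
      (nodes_leavesP_reletter_of_le_all w (min_le_left _ _) w.b_pos hnodes)
      (fun P hsc => rgFlow_of_smallCouplings_of_isRecordOfRecord₁₃CSepCoPHS hRS' P hsc)
      (by
        show BetaBoundsInInterval w.C.toB12 γ₀ 0 w.βup
        rw [hC]
        exact betaBoundsInInterval_datumOfRecord₁₃SepCoPH_of_boxH θ h hsign hhi)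
  refine ⟨hU, hθ, ?_, N24_window_of_betaUpperH (datumOfRecord₁₃SepCoPH F N θ h) hγ₀ hhi⟩
  have : ({ w with γ := min w.γ γ₀, b := w.b, b_pos := w.b_pos } : WorldP).C = (datumOfRecord₁₃SepCoPH F N θ h).C := hC
  rw [← this]
  exact hB

/-- **★ THE D-KEYED FORM AT ANY S-CLASS RECORD `(D, w)`** (dag-n10-d's `IsRecordOfRecord₁₃CSepCoPHS`): the thirteen nodes at every run, the SIGN box `0 ≤ D.βfun ≤ w.βup` on `]0, γ₀]^{k+1}`,
`0 < γ₀` ⊢ `B16.EndStatementBPrinted D.C` ∧ the non-vacuity window at `D`.  (dag-n10-d's `endStatementBPrinted_of_isRecordOfRecord₁₃CSepCoPHS_of_nodes` with its β-binder's floor lowered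
from `w.b > 0` to `0` and its window letter freed.) [cite: Balaban1989LargeFieldII, Thm 1 p.355 + p.391; Balaban1988Convergent, (2.6) p.255, Cor. 3 (2.50) p.264; Balaban1987RG1, §1 (1.22) p.264 (bookkeeping)] -/
theorem endStatementBPrinted_window_of_isRecordOfRecord₁₃CSepCoPHS_of_nodes_of_signBoxH {D : FiniteEpsData F (SU N)} {w : WorldP}
    (hRS : IsRecordOfRecord₁₃CSepCoPHS F N D w) (hnodes : ∀ P : B12.RunParams, Nodes (leavesP w P)) {γ₀ : ℝ} (hγ₀ : 0 < γ₀)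
    (hsign : BetaLowerH 0 γ₀ D.βfun) (hhi : BetaUpperH w.βup γ₀ D.βfun) :
    B16.EndStatementBPrinted D.C ∧ ∃ γ₁ : ℝ, 0 < γ₁ ∧ ∀ γ : ℝ, 0 < γ → γ ≤ γ₁ → ∃ P : B12.RunParams, 1 ≤ P.K ∧ (D.C P).flow.InInterval γ P.K := by
  obtain ⟨θ, h, hθ, hD, hC, hγ, hL, hup⟩ := hRS
  subst hD
  have hR := (recordS₁₃SepCoPH_iff F N θ h w).2 ⟨θ, h, hθ, rfl, hC, hγ, hL, hup⟩
  -- unity ∕ non-degeneracy are not read by the END road: feed the θ-keyed theorem's two pass-through slots trivially by re-proving its END part directly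
  have hRS : IsRecordOfRecord₁₃CSepCoPHS F N (datumOfRecord₁₃SepCoPH F N θ h) w := ⟨θ, h, hθ, rfl, hC, hγ, hL, hup⟩
  have hRS' : IsRecordOfRecord₁₃CSepCoPHS F N (datumOfRecord₁₃SepCoPH F N θ h) { w with γ := min w.γ γ₀, b := w.b, b_pos := w.b_pos } :=
    isRecordOfRecord₁₃CSepCoPHS_reletter_of_le hRS (lt_min hγ.1 hγ₀) (min_le_left _ _) w.b_pos
  have hB : B16.EndStatementBPrinted ({ w with γ := min w.γ γ₀, b := w.b, b_pos := w.b_pos } : WorldP).C :=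
    endStatementBPrinted_of_nodesP_interval_sign { w with γ := min w.γ γ₀, b := w.b, b_pos := w.b_pos } (lt_min hγ.1 hγ₀) (min_le_right w.γ γ₀)
      (nodes_leavesP_reletter_of_le_all w (min_le_left _ _) w.b_pos hnodes)
      (fun P hsc => rgFlow_of_smallCouplings_of_isRecordOfRecord₁₃CSepCoPHS hRS' P hsc)
      (by
        show BetaBoundsInInterval w.C.toB12 γ₀ 0 w.βup
        rw [hC]
        exact betaBoundsInInterval_datumOfRecord₁₃SepCoPH_of_boxH θ h hsign hhi)
  refine ⟨?_, N24_window_of_betaUpperH (datumOfRecord₁₃SepCoPH F N θ h) hγ₀ hhi⟩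
  have : ({ w with γ := min w.γ γ₀, b := w.b, b_pos := w.b_pos } : WorldP).C = (datumOfRecord₁₃SepCoPH F N θ h).C := hC
  rw [← this]
  exact hB

/-- **★ (B) AT θ FROM A RUNG-1 DATUM AND THE RUN-WISE SIGN ∕ CEILING LETTERS ONLY** (the minimal β-input, §1's `…_alongRuns_sign` at the record): `0 ≤ β_{j+1}(g_j) ≤ w.βup`, `j < K`,
along every run of the datum whose generated couplings `genSeq (betaOfRecord₁₃ θ) g₀` stay in `]0, w.γ]` ⊢ `B16.EndStatementBPrinted (datumOfRecord₁₃SepCoPH θ h).C` (the window conjunct is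
NOT produced here — it needs the first-step ceiling near `0⁺`, dag-n13-w4's `…N13WindowAtRecord13SepCoPH`).  World NOT re-lettered (letters already at `w.γ`).  CONDITIONAL; nothing of
Bałaban asserted. [cite: Balaban1989LargeFieldII, Thm 1 p.355 + p.391; Balaban1988Convergent, (2.6) p.255; Balaban1987RG1, (0.17)–(0.20) pp.255–256 (bookkeeping)] -/
theorem endStatementBPrinted_of_rung1At_of_alongRuns_sign (θ : Stage13HParams F N) (h : θ.Provisos₁₃SepCoPH F N) (w : WorldP)
    (hR : ∃ (θ' : Stage13HParams F N) (h' : θ'.Provisos₁₃SepCoPH F N), θ'.Admissible F N ∧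
      datumOfRecord₁₃SepCoPH F N θ h = datumOfRecord₁₃SepCoPH F N θ' h' ∧ w.C = (datumOfRecord₁₃SepCoPH F N θ h).C ∧ (0 < w.γ ∧ w.γ ≤ θ'.γ) ∧
      w.L = (θ'.L : ℝ) ∧ ∀ P : B12.RunParams, w.up P = upOfRecord₅CS F N (θ'.toStage5₁₃CoPH F N) P)
    (hnodes : ∀ P : B12.RunParams, Nodes (leavesP w P))
    (hhi : ∀ P : B12.RunParams, (genFlow (betaOfRecord₁₃ F N θ.toStage13Params) P.g0).InInterval w.γ P.K →
      ∀ j, j < P.K → (genFlow (betaOfRecord₁₃ F N θ.toStage13Params) P.g0).β (j + 1) ((genFlow (betaOfRecord₁₃ F N θ.toStage13Params) P.g0).g j) ≤ w.βup)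
    (hsign : ∀ P : B12.RunParams, (genFlow (betaOfRecord₁₃ F N θ.toStage13Params) P.g0).InInterval w.γ P.K →
      ∀ j, j < P.K → 0 ≤ (genFlow (betaOfRecord₁₃ F N θ.toStage13Params) P.g0).β (j + 1) ((genFlow (betaOfRecord₁₃ F N θ.toStage13Params) P.g0).g j)) :
    B16.EndStatementBPrinted (datumOfRecord₁₃SepCoPH F N θ h).C := by
  have hRS : IsRecordOfRecord₁₃CSepCoPHS F N (datumOfRecord₁₃SepCoPH F N θ h) w := (recordS₁₃SepCoPH_iff F N θ h w).1 hR
  have hγw : 0 < w.γ := gamma_pos_of_isRecordOfRecord₁₃CSepCoPHS hRS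
  have hC : w.C = (datumOfRecord₁₃SepCoPH F N θ h).C := construction_eq_of_isRecordOfRecord₁₃CSepCoPHS hRS
  rw [← hC]
  refine endStatementBPrinted_of_nodesP_alongRuns_sign w hγw hnodes (fun P hsc => rgFlow_of_smallCouplings_of_isRecordOfRecord₁₃CSepCoPHS hRS P hsc)
    (fun P hsc => ?_) (fun P hsc => ?_)
  · have hsc' : ((datumOfRecord₁₃SepCoPH F N θ h).C P).flow.InInterval w.γ P.K := by rw [← hC]; exact hsc
    rw [hC]; exact hhi P hsc'
  · have hsc' : ((datumOfRecord₁₃SepCoPH F N θ h).C P).flow.InInterval w.γ P.K := by rw [← hC]; exact hsc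
    rw [hC]; exact hsign P hsc'

end AtTheta

/-! ## §4. ★★ `N = 2`: the crux's consequent for `F` from the REGISTERED rung-1 text and the sign box at every rung-1 witness -/

section Registered

/-- **★★ THE CRUX's ∃-CONSEQUENT FOR `F` FROM `NodesAtSomeRecord13PWS F` (plan's v5 text VERBATIM, `RecordS` unfolded) AND THE SIGN BOX AT EVERY RUNG-1 WITNESS** («`∃ γ₀ > 0,
BetaLowerH 0 γ₀ β_θ ∧ BetaUpperH w.βup γ₀ β_θ`», receiving every rung-1 conjunct as antecedent — the weakest letter the extend-the-witness road can ask; the ceiling is the witness's own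
`w.βup` because N11 reads `flowControl` at it).  CONDITIONAL; K1⁷ NOT closed; no count moved. [cite: Balaban1989LargeFieldII, Thm 1 p.355 + (0.1) pp.355–356 + p.391; Balaban1987RG1, §1 (1.22) p.264, (0.17)–(0.20) pp.255–256; Balaban1985UV3, Thm 1 p.257 + Thm 2 p.272; Balaban1989LargeFieldI, Prop. 1 p.194 (rung-1 conjuncts passed through; bookkeeping)] -/
theorem stabilityBAtRecordR13SepCoPH_body_of_nodes13PWS_of_signBoxH_at_witness (F : T4Family)
    (hbox : ∀ (θ : Stage13HParams F 2) (h : θ.Provisos₁₃SepCoPH F 2) (w : WorldP),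
      (θ.ZhUnity F 2 ∧ θ.SlotsNondegenerate₁₃ F 2) → θ.Admissible F 2 →
      (∃ (θ' : Stage13HParams F 2) (h' : θ'.Provisos₁₃SepCoPH F 2), θ'.Admissible F 2 ∧
        datumOfRecord₁₃SepCoPH F 2 θ h = datumOfRecord₁₃SepCoPH F 2 θ' h' ∧ w.C = (datumOfRecord₁₃SepCoPH F 2 θ h).C ∧ (0 < w.γ ∧ w.γ ≤ θ'.γ) ∧
        w.L = (θ'.L : ℝ) ∧ ∀ P : B12.RunParams, w.up P = upOfRecord₅CS F 2 (θ'.toStage5₁₃CoPH F 2) P) →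
      (∀ P : B12.RunParams, Nodes (leavesP w P)) → PrintedUV3V 2 θ.L →
      (∃ lam : ResidW F 2, (∀ P : B12.RunParams, 1 ≤ P.K → lam.kSel P < P.K) ∧
        ∀ P : B12.RunParams, lam.kSel P < P.K → ((leavesP w P).rBasicStep ↔ B15Leaf (WOfRecord₁₃ F 2 θ.toStage13Params lam P))) →
      ∃ γ₀ : ℝ, 0 < γ₀ ∧ BetaLowerH 0 γ₀ (betaOfRecord₁₃ F 2 θ.toStage13Params) ∧ BetaUpperH w.βup γ₀ (betaOfRecord₁₃ F 2 θ.toStage13Params))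
    (h₁ : ∃ (θ : Stage13HParams F 2) (h : θ.Provisos₁₃SepCoPH F 2) (w : WorldP), (θ.ZhUnity F 2 ∧ θ.SlotsNondegenerate₁₃ F 2) ∧ θ.Admissible F 2 ∧
      (∃ (θ' : Stage13HParams F 2) (h' : θ'.Provisos₁₃SepCoPH F 2), θ'.Admissible F 2 ∧
        datumOfRecord₁₃SepCoPH F 2 θ h = datumOfRecord₁₃SepCoPH F 2 θ' h' ∧ w.C = (datumOfRecord₁₃SepCoPH F 2 θ h).C ∧ (0 < w.γ ∧ w.γ ≤ θ'.γ) ∧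
        w.L = (θ'.L : ℝ) ∧ ∀ P : B12.RunParams, w.up P = upOfRecord₅CS F 2 (θ'.toStage5₁₃CoPH F 2) P) ∧
      (∀ P : B12.RunParams, Nodes (leavesP w P)) ∧ PrintedUV3V 2 θ.L ∧
      ∃ lam : ResidW F 2, (∀ P : B12.RunParams, 1 ≤ P.K → lam.kSel P < P.K) ∧
        ∀ P : B12.RunParams, lam.kSel P < P.K → ((leavesP w P).rBasicStep ↔ B15Leaf (WOfRecord₁₃ F 2 θ.toStage13Params lam P))) :
    ∃ (θ : Stage13HParams F 2) (h : θ.Provisos₁₃SepCoPH F 2), (θ.ZhUnity F 2 ∧ θ.SlotsNondegenerate₁₃ F 2) ∧ θ.Admissible F 2 ∧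
      B16.EndStatementBPrinted (datumOfRecord₁₃SepCoPH F 2 θ h).C ∧
      ∃ γ₁ : ℝ, 0 < γ₁ ∧ ∀ γ : ℝ, 0 < γ → γ ≤ γ₁ → ∃ P : B12.RunParams, 1 ≤ P.K ∧ ((datumOfRecord₁₃SepCoPH F 2 θ h).C P).flow.InInterval γ P.K := by
  obtain ⟨θ, h, w, hU, hθ, hR, hnodes, h08, hlam⟩ := h₁
  obtain ⟨γ₀, hγ₀, hsign, hhi⟩ := hbox θ h w hU hθ hR hnodes h08 hlam
  exact ⟨θ, h, stabilityB_body_of_rung1At_of_signBoxH θ h w hU hθ hR hnodes hγ₀ hsign hhi⟩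

/-- **★★★ THE ROUTE DECL BY NAME FROM THE REGISTERED STUB 1 AND THE SIGN BOX AT EVERY RUNG-1 WITNESS** — an ALTERNATIVE kernel-checked composition beside plan's
`StabilityBAtRecordR13SepCoPH_of stub_nodes13PWS stub_betaWindow13PWS`: hypothesis `h₁` = the registered STUB 1 `∀ F, Inhabited13 F → NodesAtSomeRecord13PWS F` (v5 texts VERBATIM, `RecordS`
unfolded); hypothesis `hsign` = «for every `F`, at every rung-1 witness `(θ, h, w)`: `∃ γ₀ > 0, BetaLowerH 0 γ₀ β_θ ∧ BetaUpperH w.βup γ₀ β_θ`» (the SIGN of β and the ceiling — one notch BELOW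
the registered rung 2's AF floor `0 < w.b`).  Conclusion: `Summit.QuantumFields.YangMills.Theses.BalabanUVNodes.StabilityBAtRecordR13SepCoPH` — the TYPE is the route decl literally.  CONDITIONAL
on both hypotheses (neither supplied here); K1⁷ is NOT closed by this theorem; nothing of Bałaban asserted; no count moved. [cite: Balaban1989LargeFieldII, Thm 1 p.355 + (0.1) pp.355–356 + p.391; Balaban1988Convergent, (2.6) p.255 and Cor. 3 (2.50) p.264; Balaban1987RG1, Thm 2 p.259, §1 (1.22) p.264 (bookkeeping)] -/
theorem stabilityBAtRecordR13SepCoPH_of_stub1_of_signBoxH_at_witness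
    (h₁ : ∀ F : T4Family, (∃ θ : Stage13HParams F 2, θ.Provisos₁₃SepCoPH F 2 ∧ (θ.ZhUnity F 2 ∧ θ.SlotsNondegenerate₁₃ F 2) ∧ θ.Admissible F 2) →
      ∃ (θ : Stage13HParams F 2) (h : θ.Provisos₁₃SepCoPH F 2) (w : WorldP), (θ.ZhUnity F 2 ∧ θ.SlotsNondegenerate₁₃ F 2) ∧ θ.Admissible F 2 ∧
        (∃ (θ' : Stage13HParams F 2) (h' : θ'.Provisos₁₃SepCoPH F 2), θ'.Admissible F 2 ∧
          datumOfRecord₁₃SepCoPH F 2 θ h = datumOfRecord₁₃SepCoPH F 2 θ' h' ∧ w.C = (datumOfRecord₁₃SepCoPH F 2 θ h).C ∧ (0 < w.γ ∧ w.γ ≤ θ'.γ) ∧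
          w.L = (θ'.L : ℝ) ∧ ∀ P : B12.RunParams, w.up P = upOfRecord₅CS F 2 (θ'.toStage5₁₃CoPH F 2) P) ∧
        (∀ P : B12.RunParams, Nodes (leavesP w P)) ∧ PrintedUV3V 2 θ.L ∧
        ∃ lam : ResidW F 2, (∀ P : B12.RunParams, 1 ≤ P.K → lam.kSel P < P.K) ∧
          ∀ P : B12.RunParams, lam.kSel P < P.K → ((leavesP w P).rBasicStep ↔ B15Leaf (WOfRecord₁₃ F 2 θ.toStage13Params lam P)))
    (hsign : ∀ (F : T4Family) (θ : Stage13HParams F 2) (h : θ.Provisos₁₃SepCoPH F 2) (w : WorldP),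
      (θ.ZhUnity F 2 ∧ θ.SlotsNondegenerate₁₃ F 2) → θ.Admissible F 2 →
      (∃ (θ' : Stage13HParams F 2) (h' : θ'.Provisos₁₃SepCoPH F 2), θ'.Admissible F 2 ∧
        datumOfRecord₁₃SepCoPH F 2 θ h = datumOfRecord₁₃SepCoPH F 2 θ' h' ∧ w.C = (datumOfRecord₁₃SepCoPH F 2 θ h).C ∧ (0 < w.γ ∧ w.γ ≤ θ'.γ) ∧
        w.L = (θ'.L : ℝ) ∧ ∀ P : B12.RunParams, w.up P = upOfRecord₅CS F 2 (θ'.toStage5₁₃CoPH F 2) P) →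
      (∀ P : B12.RunParams, Nodes (leavesP w P)) → PrintedUV3V 2 θ.L →
      (∃ lam : ResidW F 2, (∀ P : B12.RunParams, 1 ≤ P.K → lam.kSel P < P.K) ∧
        ∀ P : B12.RunParams, lam.kSel P < P.K → ((leavesP w P).rBasicStep ↔ B15Leaf (WOfRecord₁₃ F 2 θ.toStage13Params lam P))) →
      ∃ γ₀ : ℝ, 0 < γ₀ ∧ BetaLowerH 0 γ₀ (betaOfRecord₁₃ F 2 θ.toStage13Params) ∧ BetaUpperH w.βup γ₀ (betaOfRecord₁₃ F 2 θ.toStage13Params)) :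
    Summit.QuantumFields.YangMills.Theses.BalabanUVNodes.StabilityBAtRecordR13SepCoPH := by
  intro F hinh
  exact stabilityBAtRecordR13SepCoPH_body_of_nodes13PWS_of_signBoxH_at_witness F (hsign F) (h₁ F hinh)

end Registered

/-! ## §6. The sign box supplied BY NAME from the K2 letters at θ with a NON-STRICT floor (N26 `betaBox_betaOfRecord₁₃_of_drift_atSlopeCont` at `b := 0`) -/

section Drift

variable {F : T4Family} {N : ℕ} [NeZero N]

/-- **THE CRUX's CONSEQUENT AT θ FROM A RUNG-1 DATUM AND THE K2 PAIR's LETTERS WITH THE NON-STRICT FLOOR `2A + s ≤ d`** — (D1) drift `OneLoopDrift d A β⁰_θ`, (D4) ∧ B4 residue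
`AtSlopeCont (split₁₃ θ) γ₀ s` (N26's hypotheses VERBATIM), the SIGN condition `2A + s ≤ d` (the drift letter dominates the residue, equality allowed — one notch below the companion
file's `0 < d − 2A − s`) and the ceiling `d + 2A + s ≤ w.βup`: N26 gives `BetaLowerH 0 γ₀` ∧ `BetaUpperH w.βup γ₀` BY NAME, §3 gives the consequent.  CONDITIONAL on the K2 pair;
nothing of Bałaban asserted; K1⁷ NOT closed. [cite: Balaban1987RG1, Thm 2 p.259, §1 p.264, (2.12)–(2.14) p.268 and (5.10) p.293; Balaban1988RG2Cluster, Lemma 3 (2.38) p.20; Balaban1989LargeFieldII, Thm 1 p.355 (bookkeeping)] -/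
theorem stabilityB_body_of_rung1At_of_drift_atSlopeCont_sign (θ : Stage13HParams F N) (h : θ.Provisos₁₃SepCoPH F N) (w : WorldP)
    (hU : θ.ZhUnity F N ∧ θ.SlotsNondegenerate₁₃ F N) (hθ : θ.Admissible F N)
    (hR : ∃ (θ' : Stage13HParams F N) (h' : θ'.Provisos₁₃SepCoPH F N), θ'.Admissible F N ∧
      datumOfRecord₁₃SepCoPH F N θ h = datumOfRecord₁₃SepCoPH F N θ' h' ∧ w.C = (datumOfRecord₁₃SepCoPH F N θ h).C ∧ (0 < w.γ ∧ w.γ ≤ θ'.γ) ∧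
      w.L = (θ'.L : ℝ) ∧ ∀ P : B12.RunParams, w.up P = upOfRecord₅CS F N (θ'.toStage5₁₃CoPH F N) P)
    (hnodes : ∀ P : B12.RunParams, Nodes (leavesP w P))
    {d A γ₀ s : ℝ} (hγ₀ : 0 < γ₀)
    (hdrift : letI := θ.instVβ₁; letI := θ.instVβ₂; letI := θ.instιβ
      OneLoopDrift d A (beta0OfMerged (betaMerged F (mergedTermFamilyMatT F N (TcanOfRecord F N) (chiFixed29 F N θ.ν θ.ε₂₉) θ.εbg) θ.ρ8 θ.bV) θ.v₀))
    (hres : letI := θ.instVβ₁; letI := θ.instVβ₂; letI := θ.instιβ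
      AtSlopeCont
        (oneLoopSplit_betaOfMerged (betaMerged F (mergedTermFamilyMatT F N (TcanOfRecord F N) (chiFixed29 F N θ.ν θ.ε₂₉) θ.εbg) θ.ρ8 θ.bV)
          (beta0OfMerged (betaMerged F (mergedTermFamilyMatT F N (TcanOfRecord F N) (chiFixed29 F N θ.ν θ.ε₂₉) θ.εbg) θ.ρ8 θ.bV) θ.v₀) θ.γ)
        γ₀ s)
    (hfloor : 2 * A + s ≤ d) (hceil : d + 2 * A + s ≤ w.βup) :
    (θ.ZhUnity F N ∧ θ.SlotsNondegenerate₁₃ F N) ∧ θ.Admissible F N ∧ B16.EndStatementBPrinted (datumOfRecord₁₃SepCoPH F N θ h).C ∧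
      ∃ γ₁ : ℝ, 0 < γ₁ ∧ ∀ γ : ℝ, 0 < γ → γ ≤ γ₁ → ∃ P : B12.RunParams, 1 ≤ P.K ∧ ((datumOfRecord₁₃SepCoPH F N θ h).C P).flow.InInterval γ P.K := by
  obtain ⟨hsign, hhi⟩ := betaBox_betaOfRecord₁₃_of_drift_atSlopeCont F N θ.toStage13Params hdrift hres (b := 0) (by linarith) hceil
  exact stabilityB_body_of_rung1At_of_signBoxH θ h w hU hθ hR hnodes hγ₀ hsign hhi

end Drift

end Summit.QuantumFields.YangMills.BalabanUVNodes.K1EndOfNodes13PWSOfSignBoxH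

end
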